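import Literature.AnabelianGeometry.EtaleTheta.ThetaRigidity

/-!
# Cor 2.18 (ii)–(iv) at the level of `ThetaEnvData` ([EtTh] §2, pp.60–62) — restatements

The named facts `RigidData.Cor218_ii`, `.Cor218_iii_quotient`, `.Cor218_iii_PiX`,
`.Cor218_iv_surjective`, `.Cor218_iv_fibre` of `ThetaRigidity.lean` only mention the `ThetaEnvData`
part of the interface; consumers working along a tower of levels `ThetaEnvTower.level M : ThetaEnvData M`
(Cor 2.19 (ii), `ThetaSystems.lean`) asked for them over a bare `ThetaEnvData` (abc-iut-L2-d1,
INBOX 19:48:40Z). This file restates them VERBATIM over `T : ThetaEnvData N` and proves, by `Iff.rfl`,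
that the `RigidData` facts are these restatements applied to `R.toThetaEnvData` — so nothing is
duplicated in content and either name can be discharged. Bib key `MochizukiEtTh2009`.
-/

namespace Literature.AnabelianGeometry.EtaleTheta

universe u

/-- `ThetaEnvData`-level restatement of `RigidData.Cor218_ii` (same text).
[cite: MochizukiEtTh2009, Cor 2.18(ii) p.60] -/
def ThetaEnvData.Cor218_ii {N : ℕ+} (T : ThetaEnvData.{u} N) : Prop :=
  ∀ (η η' : T.PiYdd → T.mu) (hη : η ∈ T.thetaCocycles) (hη' : η' ∈ T.thetaCocycles),
    ∃ e : (T.modelMono hη).Iso (T.modelMono hη'),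
      ∀ x, CycEnvelope.proj T.augY T.chi (e.e x) = CycEnvelope.proj T.augY T.chi x

/-- `ThetaEnvData`-level restatement of `RigidData.Cor218_iii_quotient` (same text).
[cite: MochizukiEtTh2009, Cor 2.18(iii) p.61] -/
def ThetaEnvData.Cor218_iii_quotient {N : ℕ+} (T : ThetaEnvData.{u} N) : Prop :=
  centralizerUnion T.env = (CycEnvelope.proj T.augY T.chi).ker

/-- `ThetaEnvData`-level restatement of `RigidData.Cor218_iii_PiX` (same text).
[cite: MochizukiEtTh2009, Cor 2.18(iii) p.61] -/
def ThetaEnvData.Cor218_iii_PiX {N : ℕ+} (T : ThetaEnvData.{u} N) : Prop :=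
  ∀ x : T.PiX, (∀ h : T.PiY, x * h * x⁻¹ = h) → x = 1

/-- `ThetaEnvData`-level restatement of `RigidData.Cor218_iv_surjective` (same text).
[cite: MochizukiEtTh2009, Cor 2.18(iv) p.61] -/
def ThetaEnvData.Cor218_iv_surjective {N : ℕ+} (T : ThetaEnvData.{u} N) : Prop :=
  ∀ (η : T.PiYdd → T.mu) (hη : η ∈ T.thetaCocycles) (γ : T.PiX ≃ₜ* T.PiX)
    (_ : T.PiY.map γ.toMulEquiv.toMonoidHom = T.PiY),
    ∃ α : (T.modelMono hη).Iso (T.modelMono hη),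
      ∀ x, ((CycEnvelope.proj T.augY T.chi (α.e x) : T.PiY) : T.PiX) =
        γ (CycEnvelope.proj T.augY T.chi x : T.PiY)

/-- `ThetaEnvData`-level restatement of `RigidData.Cor218_iv_fibre` (same text).
[cite: MochizukiEtTh2009, Cor 2.18(iv) p.61] -/
def ThetaEnvData.Cor218_iv_fibre {N : ℕ+} (T : ThetaEnvData.{u} N) : Prop :=
  ∀ (η : T.PiYdd → T.mu) (hη : η ∈ T.thetaCocycles),
    (∀ α : (T.modelMono hη).Iso (T.modelMono hη),
      (∀ x, CycEnvelope.proj T.augY T.chi (α.e x) = CycEnvelope.proj T.augY T.chi x) →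
      ∃ (φ : T.PiY →* T.mu) (_ : ∀ g : T.PiYdd, φ (T.inclYdd g) = 1) (c : T.mu),
        ∀ x : T.env, α.e x = MulAut.conj (CycEnvelope.inMu T.augY T.chi c)
          (CycEnvelope.inMu T.augY T.chi (φ (CycEnvelope.proj T.augY T.chi x)) * x)) ∧
    (∀ (φ : T.PiY →* T.mu), (∀ g : T.PiYdd, φ (T.inclYdd g) = 1) →
      ∃ α : (T.modelMono hη).Iso (T.modelMono hη),
        ∀ x : T.env,
          α.e x = CycEnvelope.inMu T.augY T.chi (φ (CycEnvelope.proj T.augY T.chi x)) * x)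

/-- `RigidData.Cor218_ii` IS the `ThetaEnvData`-level statement on `R.toThetaEnvData`.
[cite: MochizukiEtTh2009, Cor 2.18(ii) p.60] -/
theorem RigidData.cor218_ii_iff {N : ℕ+} {l : ℕ} (R : RigidData.{u} N l) :
    R.Cor218_ii ↔ R.toThetaEnvData.Cor218_ii := Iff.rfl

/-- `RigidData.Cor218_iii_quotient` IS the `ThetaEnvData`-level statement on `R.toThetaEnvData`.
[cite: MochizukiEtTh2009, Cor 2.18(iii) p.61] -/
theorem RigidData.cor218_iii_quotient_iff {N : ℕ+} {l : ℕ} (R : RigidData.{u} N l) :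
    R.Cor218_iii_quotient ↔ R.toThetaEnvData.Cor218_iii_quotient := Iff.rfl

/-- `RigidData.Cor218_iii_PiX` IS the `ThetaEnvData`-level statement on `R.toThetaEnvData`.
[cite: MochizukiEtTh2009, Cor 2.18(iii) p.61] -/
theorem RigidData.cor218_iii_PiX_iff {N : ℕ+} {l : ℕ} (R : RigidData.{u} N l) :
    R.Cor218_iii_PiX ↔ R.toThetaEnvData.Cor218_iii_PiX := Iff.rfl

/-- `RigidData.Cor218_iv_surjective` IS the `ThetaEnvData`-level statement on `R.toThetaEnvData`.
[cite: MochizukiEtTh2009, Cor 2.18(iv) p.61] -/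
theorem RigidData.cor218_iv_surjective_iff {N : ℕ+} {l : ℕ} (R : RigidData.{u} N l) :
    R.Cor218_iv_surjective ↔ R.toThetaEnvData.Cor218_iv_surjective := Iff.rfl

/-- `RigidData.Cor218_iv_fibre` IS the `ThetaEnvData`-level statement on `R.toThetaEnvData`.
[cite: MochizukiEtTh2009, Cor 2.18(iv) p.61] -/
theorem RigidData.cor218_iv_fibre_iff {N : ℕ+} {l : ℕ} (R : RigidData.{u} N l) :
    R.Cor218_iv_fibre ↔ R.toThetaEnvData.Cor218_iv_fibre := Iff.rfl

end Literature.AnabelianGeometry.EtaleTheta
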